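import Mathlib.NumberTheory.Padics.Complex
import Mathlib.FieldTheory.AbsoluteGaloisGroup
import Literature.AnabelianGeometry.AbsoluteAnabelian.MLFGaloisGroupsHolds
import Literature.NumberTheory.DiophantineGeometry.GenEllJInvReductionProofs
import HarnessLib

/-!
# Joshi, *Arithmetic Teichmüller Spaces III* (arXiv:2401.13508v4) §8.11, Proposition 8.11.1.1 —
# finiteness of the anabelomorphs of a `p`-adic field: TYPED over Mathlib objects and PROVED

Record/proof file of the abc-iut cell, branch E «type Joshi's construction, test vs S» (rung LADDER-ABC:A2.E;
seat abc-iut-E-t18, slot T-18 = [J-III] §8.9–8.11; companion of `Joshi/RosettaIndeterminacies.lean`).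
**No side is taken** on [IUTchIII] Cor. 3.12, on Joshi's claims, or on Mochizuki's report on them; the source is
an unrefereed arXiv preprint («Preliminary version for comments»). Locators «p.N l.M» = line M of page file
`pNNNN.txt` of the cell's render `HOME/lit/renders/Joshi-arxiv-2401.13508/` (v4).

THE PRINTED ITEM (p.92 l.31–46). «Proposition 8.11.1.1. Let E be a p-adic field contained in an algebraic
closure Q̄_p of Q_p. Then there are only finitely many p-adic fields E′ ⊂ Q̄_p such that E′ is anabelomorphic to
E. In particular, for a fixed geometric point Q̄_p (fixed for computing all the relevant fundamental groups),
there are only finitely many isomorphism classes of Fargues–Fontaine curves X_{C♭_p,E′} which are anabelomorphic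
to X_{C♭_p,E} i.e such that π^{et}_1(X_{C♭_p,E′}) = G_E. Proof. By [Joshi, 2020a], if E is a p-adic field, then
its absolute degree [E : Q_p] is an amphoric quantity i.e. for any p-adic field E′ which is anabelomorphic to E,
one has [E : Q_p] = [E′ : Q_p]. By standard results–for example Krasner's Lemma, there are only a finitely many
subfields of Q̄_p of a bounded degree over Q_p. So the assertion follows from the main theorem of [Joshi,
2020b].» Here «anabelomorphic» = having isomorphic absolute Galois groups (as topological groups), [Joshi 2020a]
= arXiv:2003.01890. The item is the finiteness clause of Joshi's reading of Mochizuki's (Ind1) («Anabelomorphy at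
all primes», §8.11.1 p.92 l.3–30, §8.11.2 p.93 l.13–19): the collection of arithmetic holomorphic structures
«over which one calculates averages» is finite at each prime.

WHAT IS TYPED AND WHAT IS PROVED. The FIRST assertion is stated over Mathlib's real objects — intermediate
fields `ℚ_p ⊆ E ⊆ Q̄_p := PadicAlgCl p` of finite degree and `Field.absoluteGaloisGroup` with its Krull topology —
as the `Prop` `AnabelomorphsFinite` (tagged as Joshi's claim), and then PROVED (`anabelomorphsFinite_holds`) from
the two classical inputs the printed proof names, both FACT-LIST facts of the cell consumed BY NAME and both
already theorems of the tree: «[E : Q_p] is amphoric» = [AbsAnab] Prop. 1.2.1 (v)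
`Literature.AnabelianGeometry.AbsoluteAnabelian.galoisMLF_iso_degrees` (F-0022, `galoisMLF_iso_degrees_holds`) and
Krasner's finiteness of the subextensions of bounded degree
`Literature.NumberTheory.DiophantineGeometry.GenEll.krasner_finite_subextensions` (F-2749,
`krasner_finite_subextensions_holds`). The SECOND assertion (isomorphism classes of Fargues–Fontaine curves) has
no carrier in Mathlib or the tree (no Fargues–Fontaine curves; `RingTheory/Perfectoid`, `WittVector`, `PreTilt`
only) and is recorded over the abstract datum of `Joshi/RosettaIndeterminacies.lean` (image of a finite set).
No new `Prop` fact is introduced. [claim: Joshi2024ATS3, status: disputed]; inputs [cite: MochizukiAbsAnab2004,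
Prop 1.2.1 (v) p.10], [cite: BombieriGubler2006, proof of Prop 4.5.3]. Standard axioms; typed ≠ endorsed.
-/

noncomputable section

namespace Summit.ABC.IUTFork.Joshi.ATS3

open Literature.AnabelianGeometry.AbsoluteAnabelian Literature.NumberTheory.DiophantineGeometry.GenEll

/-- **Anabelomorphic `p`-adic fields** inside the fixed algebraic closure `Q̄_p = PadicAlgCl p` ([J-III] p.92
l.31–32 «E′ is anabelomorphic to E»; [Joshi 2020a] = arXiv:2003.01890: `p`-adic fields with isomorphic absolute
Galois groups; p.92 l.42–43 «for any p-adic field E′ which is anabelomorphic to E»): the absolute Galois groups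
(Mathlib's `Field.absoluteGaloisGroup`, Krull topology) are isomorphic as topological groups. Definition (data of
the statement), nothing asserted. [claim: Joshi2024ATS3, status: disputed] -/
def Anabelomorphic (p : ℕ) [Fact p.Prime] (E E' : IntermediateField ℚ_[p] (PadicAlgCl p)) : Prop :=
  Nonempty (Field.absoluteGaloisGroup E ≃ₜ* Field.absoluteGaloisGroup E')

/-- **[J-III] Proposition 8.11.1.1, first assertion** (p.92 l.31–32): «Let E be a p-adic field contained in an
algebraic closure Q̄_p of Q_p. Then there are only finitely many p-adic fields E′ ⊂ Q̄_p such that E′ is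
anabelomorphic to E.» Typed over Mathlib objects: for every prime `p` and every subfield `ℚ_p ⊆ E ⊆ Q̄_p` of finite
degree, the set of subfields `E′ ⊆ Q̄_p` of finite degree over `ℚ_p` that are anabelomorphic to `E` is finite.
Joshi's CLAIM as a reading predicate (proved below from classical inputs; the tag records provenance only).
[claim: Joshi2024ATS3, status: disputed] -/
@[claim "Joshi2024ATS3" "disputed"]
def AnabelomorphsFinite : Prop :=
  ∀ (p : ℕ) [Fact p.Prime] (E : IntermediateField ℚ_[p] (PadicAlgCl p)), FiniteDimensional ℚ_[p] E →
    {E' : IntermediateField ℚ_[p] (PadicAlgCl p) | FiniteDimensional ℚ_[p] E' ∧ Anabelomorphic p E E'}.Finite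

/-- The amphoricity input of the printed proof (p.92 l.42–43 «[E : Q_p] is an amphoric quantity i.e. for any
p-adic field E′ which is anabelomorphic to E, one has [E : Q_p] = [E′ : Q_p]»), for subfields of `Q̄_p`: an
instance of the cell's FACT-LIST fact F-0022 = [AbsAnab] Prop. 1.2.1 (v) `galoisMLF_iso_degrees`, a theorem of
the tree (`galoisMLF_iso_degrees_holds`). [cite: MochizukiAbsAnab2004, Prop 1.2.1 (v) p.10] -/
theorem finrank_eq_of_anabelomorphic (p : ℕ) [Fact p.Prime] (E E' : IntermediateField ℚ_[p] (PadicAlgCl p))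
    [FiniteDimensional ℚ_[p] E] [FiniteDimensional ℚ_[p] E'] (h : Anabelomorphic p E E') :
    Module.finrank ℚ_[p] E = Module.finrank ℚ_[p] E' :=
  (galoisMLF_iso_degrees_holds p p E E' h).1

/-- **[J-III] Proposition 8.11.1.1 (first assertion) HOLDS** — proved exactly along the printed proof (p.92
l.41–46): anabelomorphs of `E` have the degree of `E` ([AbsAnab] Prop. 1.2.1 (v), F-0022), and `Q̄_p` has only
finitely many subfields of degree `≤ [E : ℚ_p]` (Krasner, F-2749 `krasner_finite_subextensions`, a theorem of
the tree). A DISCHARGED item of Joshi's §8.11: typed AND kernel-proved from two named classical facts; it says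
nothing about [IUTchIII] Cor. 3.12. [cite: MochizukiAbsAnab2004, Prop 1.2.1 (v) p.10]
[cite: BombieriGubler2006, proof of Prop 4.5.3] -/
theorem anabelomorphsFinite_holds : AnabelomorphsFinite := by
  intro p _ E hE
  refine (krasner_finite_subextensions_holds p (Module.finrank ℚ_[p] E)).subset ?_
  rintro E' ⟨hE', hα⟩
  haveI : FiniteDimensional ℚ_[p] E' := hE'
  exact ⟨hE', (finrank_eq_of_anabelomorphic p E E' hα).symm.le⟩

/-- Pointwise form: for a fixed `E` of finite degree, its anabelomorphs of finite degree inside `Q̄_p` form a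
finite set ([J-III] Prop. 8.11.1.1, p.92 l.31–32). [cite: MochizukiAbsAnab2004, Prop 1.2.1 (v) p.10]
[cite: BombieriGubler2006, proof of Prop 4.5.3] -/
theorem finite_anabelomorphs (p : ℕ) [Fact p.Prime] (E : IntermediateField ℚ_[p] (PadicAlgCl p))
    [hE : FiniteDimensional ℚ_[p] E] :
    {E' : IntermediateField ℚ_[p] (PadicAlgCl p) | FiniteDimensional ℚ_[p] E' ∧ Anabelomorphic p E E'}.Finite :=
  anabelomorphsFinite_holds p E hE

/-- The anabelomorphs of `E` all lie among the subfields of degree exactly `[E : ℚ_p]` (the amphoricity step of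
the printed proof, p.92 l.42–43, as a set inclusion). [cite: MochizukiAbsAnab2004, Prop 1.2.1 (v) p.10] -/
theorem anabelomorphs_subset_finrank_eq (p : ℕ) [Fact p.Prime] (E : IntermediateField ℚ_[p] (PadicAlgCl p))
    [FiniteDimensional ℚ_[p] E] :
    {E' : IntermediateField ℚ_[p] (PadicAlgCl p) | FiniteDimensional ℚ_[p] E' ∧ Anabelomorphic p E E'} ⊆
      {E' : IntermediateField ℚ_[p] (PadicAlgCl p) |
        FiniteDimensional ℚ_[p] E' ∧ Module.finrank ℚ_[p] E' = Module.finrank ℚ_[p] E} := by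
  rintro E' ⟨hE', hα⟩
  haveI : FiniteDimensional ℚ_[p] E' := hE'
  exact ⟨hE', (finrank_eq_of_anabelomorphic p E E' hα).symm⟩

/-- `Anabelomorphic` is reflexive (the identity of `G_E`). [folklore] -/
theorem anabelomorphic_refl (p : ℕ) [Fact p.Prime] (E : IntermediateField ℚ_[p] (PadicAlgCl p)) :
    Anabelomorphic p E E :=
  ⟨ContinuousMulEquiv.refl _⟩

/-- `Anabelomorphic` is symmetric. [folklore] -/
theorem Anabelomorphic.symm {p : ℕ} [Fact p.Prime] {E E' : IntermediateField ℚ_[p] (PadicAlgCl p)}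
    (h : Anabelomorphic p E E') : Anabelomorphic p E' E :=
  h.elim fun α => ⟨α.symm⟩

/-- `Anabelomorphic` is transitive. [folklore] -/
theorem Anabelomorphic.trans {p : ℕ} [Fact p.Prime] {E E' E'' : IntermediateField ℚ_[p] (PadicAlgCl p)}
    (h : Anabelomorphic p E E') (h' : Anabelomorphic p E' E'') : Anabelomorphic p E E'' :=
  h.elim fun α => h'.elim fun β => ⟨α.trans β⟩

/-- In particular `E` is one of its own anabelomorphs, so the finite set of Prop. 8.11.1.1 is nonempty (the
collection «over which one calculates averages», §8.11.1 p.92 l.18–23, contains `L_v` itself). [folklore] -/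
theorem self_mem_anabelomorphs (p : ℕ) [Fact p.Prime] (E : IntermediateField ℚ_[p] (PadicAlgCl p))
    [hE : FiniteDimensional ℚ_[p] E] :
    E ∈ {E' : IntermediateField ℚ_[p] (PadicAlgCl p) | FiniteDimensional ℚ_[p] E' ∧ Anabelomorphic p E E'} :=
  ⟨hE, anabelomorphic_refl p E⟩

end Summit.ABC.IUTFork.Joshi.ATS3

end
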